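import Summits.BirchSwinnertonDyer.Rank1Residual.X11b.AtomA1SelmerCertificate
import Literature.NumberTheory.EllipticCurves.Rank1Residual.Typed.HigherDescentSelmerCertificate
import HarnessLib

/-!
# X11b at `p = 3`, the `#Ш_an = 9` rows WITHOUT an Euler-system half: `BSD(E,3)` from TWO exact
# descent counts `#Sel^(3)(E/ℚ) = 27`, `#Sel^(9)(E/ℚ) = 81` — no Kolyvagin datum, no Heegner index,
# no Tamagawa condition, no (ram), no Cassels–Tate (cell `b2b-bsdres`, team `x11b3` = N8/O2, seat p5;
# sub-target E-K10(a) of `cells/x11b3/LINE-K.md` block 4, typed by planner r2)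

HONEST FRAMING (cell `b2b-bsdres`, run/shared/lean/b2b/bsd-rank1-residual/, verbatim in every
file): the goal of the cell is to DELETE the COMBINATION-SHAPED residual classes of the
Birch–Swinnerton-Dyer formula for ALL analytic-rank `≤ 1` elliptic curves over `ℚ` — "full BSD
formula for every rank `≤ 1` curve in class `C`" assembled STRICTLY from published theorems — so
that the rank-`≤ 1` remainder becomes exactly the CONSTRUCTION-SHAPED classes, which are TYPED
(missing-input `Prop`s), NOT attempted. This is not "finishing BSD". Team `x11b3` (X11b, STEP L at
`3 ∥ N`) is a RESEARCH team; no claim beyond the stated class and rows; X11b and X11 ∧ `r = 1` ∧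
`p = 3` stay CONSTRUCTION-SHAPED (REFEREE R6.2); nothing here is booked (the lane books); census
numbers quoted below are EVIDENCE pointers, never inputs. THEOREMS ONLY (no definition, no named
fact, no `sorry`).

## What this file does

It composes three PROVED tree theorems and nothing else:

* the descent count at ANY level `n` over a number field, `#Sel^(n)(E/K) = n^{rank}·#E(K)[n]·#Ш[n]`
  (`card_selmerGroup_eq_pow_rank_mul`, from the fundamental exact sequence `selmer_exact_holds`,
  Silverman *AEC* X.4.2(a), and Mordell–Weil) in its two-level reading
  `sha_stable_of_card_selmerGroup` (`Typed/HigherDescentSelmerCertificate.lean`): two consecutive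
  counts with `#Ш[p^k] = #Ш[p^(k+1)]` give STABILISATION `Ш[p^(k+1)] = Ш[p^k]` for finite `Ш`;
* `bsdp_of_card_selmer_stable` (ibid.): in analytic rank `≤ 1` (Gross–Zagier–Kolyvagin, bsd.S17,
  binder `hGZK`: `rank = r_an`, `Ш` finite) one complete `p^k`-descent plus stabilisation pins
  `ord_p #Ш(E/ℚ)` (`Ш(p) = Ш[p^k]`, `padicValNat_shaOrder_eq_of_stable`) and yields Miller's
  `BSD(E,p)` when `ord_p #Ш_an` is that number;
* `E(ℚ)[p] = 0` for `E[p]` irreducible (Mazur 1977 III.§5, tree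
  `natCard_torsionBy_eq_one_of_hasIrreducibleModPGaloisRep`), hence `E(ℚ)[p²] = 0`.

Hence (§1, class-free, EVERY prime `p`, analytic rank `≤ 1`)
**`bsdp_of_card_selmer_of_card_selmer_sq`**: `#E(ℚ)[p] = 1`, `#Sel^(p)(E/ℚ) = p^(r_an + k)`,
`#Sel^(p²)(E/ℚ) = p^(2·r_an + k)` and `ord_p #Ш(E)_an = k` ⇒ `BSD(E,p)` (so `Ш(E)(p) = Ш(E)[p] ≅
(ℤ/p)^k`: an abelian `p`-group whose `p²`-torsion has the order of its `p`-torsion has exponent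
`p`); (§1) **`bsdp_of_irr_of_card_selmer_of_card_selmer_sq`**: the same with `#E(ℚ)[p] = 1`
discharged by `E[p]` irreducible; (§2) the `p = 3`, rank-one rows in the vocabulary of `IsX11Three`
/ `ClassX11b W 3` / `ClassX11 W 3`, in particular the `#Ш_an = 9` shape
**`Three.bsdp_of_card_selmerThree_eq_of_card_selmerNine_eq`**: `IsX11Three W`, `#Sel₃ = 27`,
`#Sel₉ = 81`, `ord₃ #Ш_an = 2` ⇒ `BSD(E,3)` — literally planner r2's `EK10.Statement`
(`HOME/b2b-bsdres-x11b3-r2/ek10/EK10Sketch.lean`; its stubs S1–S3 are the three tree theorems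
above). Inputs beyond the pair: GZK ONLY. Multiplicative reduction at `3` is NOT used (it is carried
only by the class vocabulary); no Kolyvagin system, no Heegner point or index, no Tamagawa number,
no (ram) prime, no Cassels–Tate pairing, no partner curve enters — contrast the seven other
`#Ш_an = 9` consumers of this directory (`AtomA1SelmerCertificate`: A1 only;
`TamagawaAtomSelmerCertificate`: Miller Thm 5.4 / JET@3∣N + an index certificate;
`SelmerRankOne`: index `≤ 1`).

## Why (numbers, not adjectives — EVIDENCE pointers, lane data, nothing booked here)

PREDICTIONS-KOLY2 (planner r2, `cells/x11b3/PREDICTIONS-KOLY2.md`, verdict V3) stratum S-C: of the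
41 X11b@3 classes with `#Ш_an = 9` and an EXACT `#Sel₃ = 27` certificate (x11b gen 9, LB3), the five
(T2′) classes **`191424ce1, 318828a1, 368358k1, 463488bg1, 498525ca1`** (`3 ∣ ∏c_ℓ`; `318828a1`
moreover ¬(ram): `N = 2²·3·163²`) have NO Kolyvagin-type upper half of record (every Heegner field
of record has `ord₃ I_K = 2`, and a derived-class datum bounds the wrong side there). Given LB3,
published knowledge leaves `Ш(E)(3) ∈ {(ℤ/3)², (ℤ/9)², …}`; the ONE further finite datum
`#Sel^(9)(E/ℚ) = 81` (a second `3`-descent — Creutz, Math. Comp. 83 (2014) — equivalently the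
Cassels–Tate pairing on `Sel^(3)` with kernel `E(ℚ)/3E(ℚ)` — Fisher–Newton, IJNT 10 (2014) §1) kills
everything but `(ℤ/3)²`. That datum is NOT in hand (no held engine does a `9`-descent; LINE-K E-K10(b)
asks for a Magma seat); this file is the kernel consumer it would feed, per pair. Print precedent for
reading "`Ш[ℓ^∞] = Ш[ℓ]`" off a second descent: Creutz–Miller, J. Algebra 372 (2012) §1 / §7.

References: [SilvermanAEC2009] Thm. X.4.2(a), VIII.6.7; [Mazur1977] III.§5 p. 157; [Miller2011LMS]
§1, Def. 1.1; [Creutz2014] §1; [FisherNewton2014] §1; [CreutzMiller2012] §1; cell files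
`Typed/HigherDescentCertificate.lean`, `Typed/HigherDescentSelmerCertificate.lean`,
`X11b/AtomA1SelmerCertificate.lean`, `cells/x11b3/LINE-K.md` block 4, `cells/x11b3/PREDICTIONS-KOLY2.md`.
-/

noncomputable section

open scoped Classical

open WeierstrassCurve NumberField Literature.NumberTheory.EllipticCurves
  Literature.NumberTheory.EllipticCurves.Rank1Residual
  Literature.NumberTheory.EllipticCurves.Rank1Residual.Typed

namespace Summit.BirchSwinnertonDyer.Rank1Residual.X11b.Three

/-! ### §1. Class-free, every prime: two consecutive descent counts pin `ord_p #Ш` -/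

section AnyPrime

variable (W : WeierstrassCurve ℚ) [W.IsElliptic] (p : ℕ) [hp : Fact p.Prime]

omit [W.IsElliptic] hp in
/-- **No rational `p`-torsion ⇒ no rational `p²`-torsion**: `#E(ℚ)[p] = 1 ⇒ #E(ℚ)[p²] = 1`
(`p·(p·x) = 0 ⇒ p·x ∈ E(ℚ)[p] = 0 ⇒ x ∈ E(ℚ)[p] = 0`). Elementary bookkeeping. [folklore] -/
theorem natCard_torsionBy_sq_eq_one_of_natCard_torsionBy_eq_one
    (h : Nat.card (AddSubgroup.torsionBy W.toAffine.Point (p : ℤ)) = 1) :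
    Nat.card (AddSubgroup.torsionBy W.toAffine.Point ((p ^ 2 : ℕ) : ℤ)) = 1 := by
  have hbot : AddSubgroup.torsionBy W.toAffine.Point (p : ℤ) = ⊥ :=
    AddSubgroup.eq_bot_of_card_eq _ h
  rw [AddSubgroup.card_eq_one, eq_bot_iff]
  intro x hx
  rw [AddSubgroup.mem_bot]
  have hx' : p ^ 2 • x = 0 := AddSubgroup.torsionBy.nsmul_iff.mp hx
  have hpx : p • x ∈ AddSubgroup.torsionBy W.toAffine.Point (p : ℤ) := by
    apply AddSubgroup.torsionBy.nsmul_iff.mpr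
    rw [← mul_nsmul', ← pow_two, hx']
  rw [hbot, AddSubgroup.mem_bot] at hpx
  have hxp : x ∈ AddSubgroup.torsionBy W.toAffine.Point (p : ℤ) :=
    AddSubgroup.torsionBy.nsmul_iff.mpr hpx
  rwa [hbot, AddSubgroup.mem_bot] at hxp

/-- **`BSD(E,p)` in analytic rank `≤ 1` from TWO exact descent counts, class-free, every prime `p`.**
Hypotheses: Gross–Zagier–Kolyvagin (`hGZK`, bsd.S17: `rank E(ℚ) = r_an`, `Ш(E/ℚ)` finite);
`#E(ℚ)[p] = 1`; the complete `p`-descent `#Sel^(p)(E/ℚ) = p^(r_an + k)`; the complete `p²`-descent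
`#Sel^(p²)(E/ℚ) = p^(2·r_an + k)`; `#Ш(E)_an = s ∈ ℚ` with `ord_p s = k`. Proof: the descent count
(`card_selmerGroup_eq_pow_rank_mul`, Silverman X.4.2(a) + Mordell–Weil) gives `#Ш[p] = #Ш[p²] = p^k`
(no rational `p`- or `p²`-torsion), so `Ш[p²] = Ш[p]` (`sha_stable_of_card_selmerGroup`), the
`p`-primary part of `Ш` IS `Ш[p]`, `ord_p #Ш = k` (`bsdp_of_card_selmer_stable`). No Euler system, no
Heegner datum, no Tamagawa number, no Cassels–Tate pairing. Per pair (two certificates); NOT a class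
theorem; nothing booked. [cite: SilvermanAEC2009, Thm. X.4.2(a) and Thm. VIII.6.7]
[cite: Miller2011LMS, §1 and Def. 1.1 (arXiv:1010.2431 p. 3)] [cite: Creutz2014, §1 (second `p`-descent)]
[cite: CreutzMiller2012, §1 (reading `Ш[ℓ^∞]` off a second descent)] -/
theorem bsdp_of_card_selmer_of_card_selmer_sq (hGZK : rank_eq_analyticRank_of_analyticRank_le_one)
    (hr : W.analyticRank ≤ 1)
    (htors : Nat.card (AddSubgroup.torsionBy W.toAffine.Point (p : ℤ)) = 1) {k : ℕ}
    (h1 : Nat.card (W.selmerGroup (p : ℤ)) = p ^ (W.analyticRank + k))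
    (h2 : Nat.card (W.selmerGroup ((p ^ 2 : ℕ) : ℤ)) = p ^ (2 * W.analyticRank + k))
    {s : ℚ} (hs : shaAn W = (s : ℂ)) (hv : padicValRat p s = k) : BSDp W p := by
  obtain ⟨hrank, hfin⟩ := hGZK W hr
  have htors2 := natCard_torsionBy_sq_eq_one_of_natCard_torsionBy_eq_one W p htors
  -- transport the computable `DecidableEq ℚ` of the binders to the classical one of the general
  -- number-field theorems (as in `Typed/HigherDescentSelmerCertificate.lean`)
  have hinst : (instDecidableEqRat : DecidableEq ℚ) = fun a b => Classical.propDecidable (a = b) :=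
    Subsingleton.elim _ _
  have htors' := htors
  have htors2' := htors2
  rw [hinst] at htors' htors2'
  -- stabilisation `Ш[p²] = Ш[p]` from the two counts
  have hstab : ∀ x : W.sha, p ^ (1 + 1) • x = 0 → p ^ 1 • x = 0 := by
    refine sha_stable_of_card_selmerGroup W p 1 hfin (a := p ^ W.analyticRank)
      (a' := p ^ (2 * W.analyticRank)) (c := p ^ k) ?_ ?_ (pow_pos hp.out.pos _)
      (pow_pos hp.out.pos _) ?_ ?_
    · rw [pow_one, hrank, htors', mul_one]
    · rw [hrank, htors2', mul_one, ← pow_mul]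
    · rw [pow_one, h1, pow_add]
    · rw [h2, pow_add]
  -- one complete `p`-descent + stabilisation ⇒ `BSD(E,p)`
  refine bsdp_of_card_selmer_stable W p hGZK hr (k := 1) (m := k) (b := 1) ?_ Nat.one_pos ?_ hstab
    hs hv
  · rw [pow_one]; exact htors
  · rw [pow_one, h1, pow_add, mul_one]

/-- **The same with `#E(ℚ)[p] = 1` discharged by irreducibility of `E[p]`** (a rational point of
order `p` spans a `Γ_ℚ`-stable line; Mazur 1977 p. 157, tree
`natCard_torsionBy_eq_one_of_hasIrreducibleModPGaloisRep`). Class-free, every prime, analytic rank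
`≤ 1`; per pair; nothing booked. [cite: Mazur1977, Ch. III §5, p. 157]
[cite: SilvermanAEC2009, Thm. X.4.2(a)] [cite: Miller2011LMS, §1 and Def. 1.1] -/
theorem bsdp_of_irr_of_card_selmer_of_card_selmer_sq
    (hGZK : rank_eq_analyticRank_of_analyticRank_le_one) (hr : W.analyticRank ≤ 1) (hirr : Irr W p)
    {k : ℕ} (h1 : Nat.card (W.selmerGroup (p : ℤ)) = p ^ (W.analyticRank + k))
    (h2 : Nat.card (W.selmerGroup ((p ^ 2 : ℕ) : ℤ)) = p ^ (2 * W.analyticRank + k))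
    {s : ℚ} (hs : shaAn W = (s : ℂ)) (hv : padicValRat p s = k) : BSDp W p :=
  bsdp_of_card_selmer_of_card_selmer_sq W p hGZK hr
    (natCard_torsionBy_eq_one_of_hasIrreducibleModPGaloisRep W p hirr) h1 h2 hs hv

end AnyPrime

/-! ### §2. The `p = 3`, rank-one rows: `#Sel₃ = 3^(1+k)`, `#Sel₉ = 3^(2+k)`, `ord₃ #Ш_an = k` -/

section Three

variable (W : WeierstrassCurve ℚ) [W.IsElliptic]

/-- **Rank one at `p = 3`, `E[3]` irreducible: `#Sel^(3)(E/ℚ) = 3^(1+k)`, `#Sel^(9)(E/ℚ) = 3^(2+k)`,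
`ord₃ #Ш(E)_an = k` ⇒ `BSD(E,3)`** — `bsdp_of_irr_of_card_selmer_of_card_selmer_sq` at `p = 3`,
`r_an = 1`. The reduction type at `3` is irrelevant. Per pair; X11 ∧ `r = 1` ∧ `p = 3` stays
CONSTRUCTION-SHAPED (REFEREE R6.2); nothing booked. [cite: SilvermanAEC2009, Thm. X.4.2(a)]
[cite: Mazur1977, Ch. III §5, p. 157] [cite: Miller2011LMS, §1 and Def. 1.1] -/
theorem bsdp_three_of_irr_of_card_selmerThree_of_card_selmerNine
    (hGZK : rank_eq_analyticRank_of_analyticRank_le_one) (hr : W.analyticRank = 1) (hirr : Irr W 3)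
    {k : ℕ} (h3 : Nat.card (W.selmerGroup (3 : ℤ)) = 3 ^ (1 + k))
    (h9 : Nat.card (W.selmerGroup (9 : ℤ)) = 3 ^ (2 + k))
    {s : ℚ} (hs : shaAn W = (s : ℂ)) (hv : padicValRat 3 s = k) : BSDp W 3 :=
  haveI : Fact (Nat.Prime 3) := ⟨Nat.prime_three⟩
  bsdp_of_irr_of_card_selmer_of_card_selmer_sq W 3 hGZK hr.le hirr (k := k)
    (by rw [hr, show ((3 : ℕ) : ℤ) = 3 by norm_num]; exact h3)
    (by rw [hr, show ((3 ^ 2 : ℕ) : ℤ) = 9 by norm_num]; exact h9) hs hv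

/-- **E-K10(a) — planner r2's `EK10.Statement`, literally.** X11 at `p = 3` in analytic rank one
(`IsX11Three W`: mult(3) ∧ irr(3) ∧ `r_an = 1`), with the TWO exact descent certificates
`#Sel^(3)(E/ℚ) = 27` (LB3) and `#Sel^(9)(E/ℚ) = 81` (second `3`-descent / Cassels–Tate on
`Sel^(3)`), and `#Ш(E)_an = s` with `ord₃ s = 2`: then `BSD(E,3)`. Inputs beyond the pair:
Gross–Zagier–Kolyvagin (`hGZK`) only; `Ш(E)(3) = Ш(E)[3] ≅ (ℤ/3)²`. NO Kolyvagin system, NO Heegner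
index, NO Tamagawa condition, NO (ram) prime, NO Cassels–Tate input in the kernel. EVIDENCE pointer
(lane data; nothing booked here; the `#Sel₉` datum is NOT in hand): the five (T2′) ∧ `#Ш_an = 9`
classes `191424ce1, 318828a1, 368358k1, 463488bg1, 498525ca1` of PREDICTIONS-KOLY2 stratum S-C
(incl. the ¬(ram) class `318828a1`). Per pair; label unchanged.
[cite: SilvermanAEC2009, Thm. X.4.2(a)] [cite: Mazur1977, Ch. III §5, p. 157]
[cite: Miller2011LMS, §1 and Def. 1.1] [cite: Creutz2014, §1] [cite: FisherNewton2014, §1] -/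
theorem bsdp_of_card_selmerThree_eq_of_card_selmerNine_eq
    (hGZK : rank_eq_analyticRank_of_analyticRank_le_one) (W : WeierstrassCurve ℚ) [W.IsElliptic]
    [W.IsGloballyMinimal] (hX : IsX11Three W) (h3 : Nat.card (W.selmerGroup (3 : ℤ)) = 27)
    (h9 : Nat.card (W.selmerGroup (9 : ℤ)) = 81) {s : ℚ} (hs : shaAn W = (s : ℂ))
    (hv : padicValRat 3 s = 2) : BSDp W 3 :=
  bsdp_three_of_irr_of_card_selmerThree_of_card_selmerNine W hGZK hX.rank hX.irr (k := 2)
    (by rw [h3]; norm_num) (by rw [h9]; norm_num) hs (by exact_mod_cast hv)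

/-- **The same rows for general `k` in the vocabulary of `IsX11Three`**: `#Sel^(3)(E/ℚ) = 3^(1+k)`,
`#Sel^(9)(E/ℚ) = 3^(2+k)`, `ord₃ #Ш(E)_an = k` ⇒ `BSD(E,3)` (`k = 0`: `#Sel₃ = 3`, then `#Sel₉ = 9`
is automatic and the T-SEL3 shape `Typed.X11.bsdp_three_of_card_selmerThree_pow` already closes;
`k = 2`: the LB3 ∧ `#Sel₉ = 81` shape above). Per pair; nothing booked.
[cite: SilvermanAEC2009, Thm. X.4.2(a)] [cite: Miller2011LMS, §1 and Def. 1.1] -/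
theorem IsX11Three.bsdp_of_card_selmerThree_of_card_selmerNine
    (hGZK : rank_eq_analyticRank_of_analyticRank_le_one) (W : WeierstrassCurve ℚ) [W.IsElliptic]
    (hX : IsX11Three W) {k : ℕ} (h3 : Nat.card (W.selmerGroup (3 : ℤ)) = 3 ^ (1 + k))
    (h9 : Nat.card (W.selmerGroup (9 : ℤ)) = 3 ^ (2 + k)) {s : ℚ} (hs : shaAn W = (s : ℂ))
    (hv : padicValRat 3 s = k) : BSDp W 3 :=
  bsdp_three_of_irr_of_card_selmerThree_of_card_selmerNine W hGZK hX.rank hX.irr h3 h9 hs hv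

/-- **The same in the vocabulary of the partition row `ClassX11b W 3`** (`r_an = 1 ∧ 3 ≠ 2 ∧ mult(3) ∧
irr(3)`, `Partition/Rows.lean`): `#Sel₃ = 27`, `#Sel₉ = 81`, `ord₃ #Ш_an = 2` ⇒ `BSD(E,3)`. Per pair;
X11b stays CONSTRUCTION-SHAPED; nothing booked. [cite: SilvermanAEC2009, Thm. X.4.2(a)]
[cite: Miller2011LMS, §1 and Def. 1.1] -/
theorem ClassX11b.bsdp_three_of_card_selmerThree_eq_of_card_selmerNine_eq
    (hGZK : rank_eq_analyticRank_of_analyticRank_le_one) (W : WeierstrassCurve ℚ) [W.IsElliptic]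
    (hX : ClassX11b W 3) (h3 : Nat.card (W.selmerGroup (3 : ℤ)) = 27)
    (h9 : Nat.card (W.selmerGroup (9 : ℤ)) = 81) {s : ℚ} (hs : shaAn W = (s : ℂ))
    (hv : padicValRat 3 s = 2) : BSDp W 3 :=
  bsdp_three_of_irr_of_card_selmerThree_of_card_selmerNine W hGZK hX.1 hX.2.2.2 (k := 2)
    (by rw [h3]; norm_num) (by rw [h9]; norm_num) hs (by exact_mod_cast hv)

/-- **The same in the vocabulary of the census class `ClassX11 W 3`** (`mult(3) ∧ irr(3) ∧ …`,
`Rank1Residual/Predicates.lean`) at analytic rank one, as in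
`X11.bsdp_three_of_ram_of_not_dvd_of_card_selmerThree` (`AtomA1SelmerCertificate.lean`) but with the
atom condition (ram) ∧ `3 ∤ ∏c_ℓ` REPLACED by the second descent count: `#Sel₃ = 3^(1+k)`,
`#Sel₉ = 3^(2+k)`, `ord₃ #Ш_an = k` ⇒ `BSD(E,3)`. Per pair; nothing booked.
[cite: SilvermanAEC2009, Thm. X.4.2(a)] [cite: Miller2011LMS, §1 and Def. 1.1] -/
theorem X11.bsdp_three_of_card_selmerThree_of_card_selmerNine
    (hGZK : rank_eq_analyticRank_of_analyticRank_le_one) (W : WeierstrassCurve ℚ) [W.IsElliptic]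
    [W.IsGloballyMinimal] (hX : ClassX11 W 3) (hr : W.analyticRank = 1) {k : ℕ}
    (h3 : Nat.card (W.selmerGroup (3 : ℤ)) = 3 ^ (1 + k))
    (h9 : Nat.card (W.selmerGroup (9 : ℤ)) = 3 ^ (2 + k)) {s : ℚ} (hs : shaAn W = (s : ℂ))
    (hv : padicValRat 3 s = k) : BSDp W 3 :=
  bsdp_three_of_irr_of_card_selmerThree_of_card_selmerNine W hGZK hr hX.2.1 h3 h9 hs hv

end Three

end Summit.BirchSwinnertonDyer.Rank1Residual.X11b.Three

end
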